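import Summits.CriticalPhenomena.PercolationContinuityZ3.Theorems.PercNearOneGluingNoHeavyLowerTailSunflowerMinorPetal
import HarnessLib

/-!
# `NoHeavyLowerTail` (crux stmt-CriticalPhenomena-4575), abstract sunflower cubic: ordered 3-partitions INSIDE a finite set, their block
# symmetries, the Harris/Gladkov count summed over a free block, and the TRACE DECOMPOSITION of the ordered 3-partitions of the ground type
# along a fixed set `S₀`

Support file (seat `prim-ineq-gen-2` gen 22; `--supports stmt-CriticalPhenomena-4575`).  Nothing is asserted about the crux; no `sorry`, no named facts.
Pure counting infrastructure for `…SunflowerOrPetal` (★ for sunflowers with a disjunctive petal).  Memo: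
run/shared/lean/prim/prim-ineq-gen-2/SPECTATOR-TRANSFER-GEN22.md §7.

* block symmetries `sum_partsOf_swap12`, `sum_partsOf_swap13`, `sum_partsOf_swap23`, `sum_partsOf_rot`, `sum_partsOf_rot'` of the sums over
  `partsOf W` (the tree's ordered 3-partitions `(X, Y, W ∖ (X ∪ Y))` of a finset `W`: `partsOf`, `…SunflowerPartitionReduction`; `Sunflower.mem_partsOf_iff`, `…SunflowerMinorPetal`).
* `Sunflower.sum_partsOf_kk_nonneg` — `0 ≤ Σ_{(X,Y,Z) ∈ partsOf W} kk (lab Y) (lab Z)`: antipodal Gladkov (`Sunflower.antipodal_gladkov`) on the window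
  `W ∖ X` behind every first block `X`.
* `sum_parts_eq_sum_traces` — `Σ_{q ∈ parts α} f q = Σ_{s ∈ partsOf S₀} Σ_{q ∈ parts α, traces of q on S₀ = s} f q`, and the TRANSFER
  `sum_parts_trace_eq` identifying the inner sum with a sum over `partsOf S₀ᶜ` of `f` at the blocks `X ∪ s.1, Y ∪ s.2, Z ∪ (S₀ ∖ (s.1 ∪ s.2))`.
-/

namespace Summit.CriticalPhenomena.PercolationContinuityZ3.Theorems.SunflowerPartition

open Finset

variable {α : Type*} [DecidableEq α]

/-! ## Ordered 3-partitions of a finset (`partsOf`, tree) and their block symmetries -/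

/-- Swapping the first two blocks. [this work] -/
theorem sum_partsOf_swap12 (W : Finset α) (g : Finset α → Finset α → Finset α → ℤ) :
    ∑ r ∈ partsOf W, g r.1 r.2 (W \ (r.1 ∪ r.2)) = ∑ r ∈ partsOf W, g r.2 r.1 (W \ (r.1 ∪ r.2)) := by
  refine sum_nbij' (fun r => (r.2, r.1)) (fun r => (r.2, r.1)) ?_ ?_ ?_ ?_ ?_
  · intro r hr
    rw [Sunflower.mem_partsOf_iff] at hr ⊢
    exact ⟨hr.2.1, hr.1, hr.2.2.symm⟩
  · intro r hr
    rw [Sunflower.mem_partsOf_iff] at hr ⊢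
    exact ⟨hr.2.1, hr.1, hr.2.2.symm⟩
  · intro r _; rfl
  · intro r _; rfl
  · intro r _
    simp only [union_comm]

/-- For disjoint `X, Y ⊆ W`: `W ∖ ((W ∖ (X ∪ Y)) ∪ Y) = X`. [folklore] -/
theorem sdiff_sdiff_union_eq {W X Y : Finset α} (hX : X ⊆ W) (hd : Disjoint X Y) :
    W \ ((W \ (X ∪ Y)) ∪ Y) = X := by
  ext x
  have hdx : x ∈ X → x ∉ Y := fun hx => Finset.disjoint_left.1 hd hx
  have hXW : x ∈ X → x ∈ W := fun hx => hX hx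
  simp only [mem_sdiff, mem_union]
  tauto

/-- Swapping the first and third blocks. [this work] -/
theorem sum_partsOf_swap13 (W : Finset α) (g : Finset α → Finset α → Finset α → ℤ) :
    ∑ r ∈ partsOf W, g r.1 r.2 (W \ (r.1 ∪ r.2)) = ∑ r ∈ partsOf W, g (W \ (r.1 ∪ r.2)) r.2 r.1 := by
  refine sum_nbij' (fun r => (W \ (r.1 ∪ r.2), r.2)) (fun r => (W \ (r.1 ∪ r.2), r.2)) ?_ ?_ ?_ ?_ ?_
  · intro r hr
    rw [Sunflower.mem_partsOf_iff] at hr ⊢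
    exact ⟨sdiff_subset, hr.2.1, disjoint_sdiff_self_left.mono_right subset_union_right⟩
  · intro r hr
    rw [Sunflower.mem_partsOf_iff] at hr ⊢
    exact ⟨sdiff_subset, hr.2.1, disjoint_sdiff_self_left.mono_right subset_union_right⟩
  · intro r hr
    rw [Sunflower.mem_partsOf_iff] at hr
    simp only [sdiff_sdiff_union_eq hr.1 hr.2.2]
  · intro r hr
    rw [Sunflower.mem_partsOf_iff] at hr
    simp only [sdiff_sdiff_union_eq hr.1 hr.2.2]
  · intro r hr
    rw [Sunflower.mem_partsOf_iff] at hr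
    simp only [sdiff_sdiff_union_eq hr.1 hr.2.2]

/-- Swapping the last two blocks. [this work] -/
theorem sum_partsOf_swap23 (W : Finset α) (g : Finset α → Finset α → Finset α → ℤ) :
    ∑ r ∈ partsOf W, g r.1 r.2 (W \ (r.1 ∪ r.2)) = ∑ r ∈ partsOf W, g r.1 (W \ (r.1 ∪ r.2)) r.2 := by
  rw [sum_partsOf_swap13 W g, sum_partsOf_swap12 W (fun a b c => g c b a), sum_partsOf_swap13 W (fun a b c => g c a b)]

/-- Cyclic rotation of the blocks: `g(X,Y,Z) ↦ g(Z,X,Y)`. [this work] -/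
theorem sum_partsOf_rot (W : Finset α) (g : Finset α → Finset α → Finset α → ℤ) :
    ∑ r ∈ partsOf W, g r.1 r.2 (W \ (r.1 ∪ r.2)) = ∑ r ∈ partsOf W, g (W \ (r.1 ∪ r.2)) r.1 r.2 := by
  rw [sum_partsOf_swap12 W g, sum_partsOf_swap23 W (fun a b c => g b a c)]

/-- Cyclic rotation of the blocks: `g(X,Y,Z) ↦ g(Y,Z,X)`. [this work] -/
theorem sum_partsOf_rot' (W : Finset α) (g : Finset α → Finset α → Finset α → ℤ) :
    ∑ r ∈ partsOf W, g r.1 r.2 (W \ (r.1 ∪ r.2)) = ∑ r ∈ partsOf W, g r.2 (W \ (r.1 ∪ r.2)) r.1 := by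
  rw [sum_partsOf_swap13 W g, sum_partsOf_swap23 W (fun a b c => g c b a)]

/-- A sum over `partsOf W` as an iterated sum over the first block and the second block inside its complement. [this work] -/
theorem sum_partsOf_eq_sum_powerset (W : Finset α) (g : Finset α → Finset α → ℤ) :
    ∑ r ∈ partsOf W, g r.1 r.2 = ∑ X ∈ W.powerset, ∑ Y ∈ (W \ X).powerset, g X Y := by
  unfold partsOf
  rw [sum_filter, sum_product]
  refine sum_congr rfl fun X hX => ?_
  rw [mem_powerset] at hX
  rw [← sum_filter]
  refine sum_congr ?_ fun _ _ => rfl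
  ext Y
  simp only [mem_filter, mem_powerset, subset_sdiff, disjoint_comm]

/-! ## The Gladkov count summed over a free first block -/

namespace Sunflower

variable (F : Sunflower α)

/-- **`0 ≤ Σ_{(X,Y,Z) ∈ partsOf W} kk (lab Y) (lab Z)`** — antipodal Gladkov on the window `W ∖ X` for every first block `X`. [this work] -/
theorem sum_partsOf_kk_nonneg (W : Finset α) :
    0 ≤ ∑ r ∈ partsOf W, kk (F.lab r.2) (F.lab (W \ (r.1 ∪ r.2))) := by
  rw [sum_partsOf_eq_sum_powerset W (fun X Y => kk (F.lab Y) (F.lab (W \ (X ∪ Y))))]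
  refine sum_nonneg fun X _ => ?_
  have h := F.antipodal_gladkov (W \ X)
  refine le_of_le_of_eq h (sum_congr rfl fun Y _ => ?_)
  congr 2
  ext x
  simp only [mem_sdiff, mem_union]
  tauto

end Sunflower

/-! ## Trace decomposition of `parts α` along a fixed set `S₀` -/

variable [Fintype α]

/-- The ordered 3-partitions of `α`, regrouped by the traces of their first two blocks on `S₀`. [this work] -/
theorem sum_parts_eq_sum_traces (S₀ : Finset α) (f : Finset α × Finset α → ℤ) :
    ∑ q ∈ parts α, f q = ∑ s ∈ partsOf S₀, ∑ q ∈ (parts α).filter (fun q => q.1 ∩ S₀ = s.1 ∧ q.2 ∩ S₀ = s.2), f q := by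
  rw [← sum_fiberwise_of_maps_to (s := parts α) (t := partsOf S₀) (g := fun q => (q.1 ∩ S₀, q.2 ∩ S₀))]
  · refine sum_congr rfl fun s _ => sum_congr ?_ fun _ _ => rfl
    ext q
    simp only [mem_filter, Prod.ext_iff]
  · intro q hq
    unfold parts at hq
    rw [mem_filter] at hq
    rw [Sunflower.mem_partsOf_iff]
    exact ⟨inter_subset_right, inter_subset_right, hq.2.mono inter_subset_left inter_subset_left⟩

/-- **TRANSFER**: for a trace `s ∈ partsOf S₀`, the ordered 3-partitions of `α` with first-block trace `s.1` and second-block trace `s.2` correspond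
to the ordered 3-partitions `(X,Y,Z)` of `S₀ᶜ` via `(X ∪ s.1, Y ∪ s.2, Z ∪ (S₀ ∖ (s.1 ∪ s.2)))`. [this work] -/
theorem sum_parts_trace_eq (S₀ : Finset α) {s : Finset α × Finset α} (hs : s ∈ partsOf S₀) (g : Finset α → Finset α → Finset α → ℤ) :
    ∑ q ∈ (parts α).filter (fun q => q.1 ∩ S₀ = s.1 ∧ q.2 ∩ S₀ = s.2), g q.1 q.2 (q.1 ∪ q.2)ᶜ
      = ∑ r ∈ partsOf S₀ᶜ, g (r.1 ∪ s.1) (r.2 ∪ s.2) ((S₀ᶜ \ (r.1 ∪ r.2)) ∪ (S₀ \ (s.1 ∪ s.2))) := by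
  rw [Sunflower.mem_partsOf_iff] at hs
  obtain ⟨hs1, hs2, hsd⟩ := hs
  refine sum_nbij' (fun q => (q.1 \ S₀, q.2 \ S₀)) (fun r => (r.1 ∪ s.1, r.2 ∪ s.2)) ?_ ?_ ?_ ?_ ?_
  · intro q hq
    rw [mem_filter] at hq
    unfold parts at hq
    rw [mem_filter] at hq
    rw [Sunflower.mem_partsOf_iff]
    refine ⟨fun x hx => ?_, fun x hx => ?_, hq.1.2.mono sdiff_subset sdiff_subset⟩
    · rw [mem_sdiff] at hx; exact mem_compl.2 hx.2
    · rw [mem_sdiff] at hx; exact mem_compl.2 hx.2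
  · intro r hr
    rw [Sunflower.mem_partsOf_iff] at hr
    obtain ⟨hr1, hr2, hrd⟩ := hr
    rw [mem_filter]
    unfold parts
    rw [mem_filter]
    have d1 : Disjoint r.1 S₀ := Finset.disjoint_left.2 fun x hx hxS => (mem_compl.1 (hr1 hx)) hxS
    have d2 : Disjoint r.2 S₀ := Finset.disjoint_left.2 fun x hx hxS => (mem_compl.1 (hr2 hx)) hxS
    refine ⟨⟨mem_univ _, ?_⟩, ?_, ?_⟩
    · rw [disjoint_union_left, disjoint_union_right, disjoint_union_right]
      exact ⟨⟨hrd, d1.mono_right hs2⟩, ⟨(d2.mono_right hs1).symm, hsd⟩⟩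
    · rw [union_inter_distrib_right, disjoint_iff_inter_eq_empty.1 d1, empty_union, inter_eq_left.2 hs1]
    · rw [union_inter_distrib_right, disjoint_iff_inter_eq_empty.1 d2, empty_union, inter_eq_left.2 hs2]
  · intro q hq
    rw [mem_filter] at hq
    obtain ⟨_, h1, h2⟩ := hq
    ext <;> simp only []
    · rw [← h1, sdiff_union_inter]
    · rw [← h2, sdiff_union_inter]
  · intro r hr
    rw [Sunflower.mem_partsOf_iff] at hr
    obtain ⟨hr1, hr2, _⟩ := hr
    have e1 : (r.1 ∪ s.1) \ S₀ = r.1 := by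
      rw [union_sdiff_distrib, sdiff_eq_empty_iff_subset.2 hs1, union_empty]
      exact sdiff_eq_self_of_disjoint (Finset.disjoint_left.2 fun x hx hxS => (mem_compl.1 (hr1 hx)) hxS)
    have e2 : (r.2 ∪ s.2) \ S₀ = r.2 := by
      rw [union_sdiff_distrib, sdiff_eq_empty_iff_subset.2 hs2, union_empty]
      exact sdiff_eq_self_of_disjoint (Finset.disjoint_left.2 fun x hx hxS => (mem_compl.1 (hr2 hx)) hxS)
    ext <;> simp only [e1, e2]
  · intro q hq
    rw [mem_filter] at hq
    obtain ⟨_, h1, h2⟩ := hq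
    have e1 : q.1 \ S₀ ∪ s.1 = q.1 := by rw [← h1, sdiff_union_inter]
    have e2 : q.2 \ S₀ ∪ s.2 = q.2 := by rw [← h2, sdiff_union_inter]
    rw [e1, e2, ← h1, ← h2]
    congr 1
    ext x
    simp only [mem_compl, mem_union, mem_sdiff, mem_inter]
    tauto

end Summit.CriticalPhenomena.PercolationContinuityZ3.Theorems.SunflowerPartition
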